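import Summits.ABC.IUTFork.Repair.RHTameBandLicenceSigmaAbc
import Summits.ABC.IUTFork.Repair.RHTameBandLicenceBall
import Summits.ABC.IUTFork.Cor312LicenceBallFibreMovers
import Literature.IUT.LogVolume.UnitLogTorsionFreeBallCriterion
import HarnessLib

/-!
# IUT REPAIR branch → R-H ROUND 2, Q2(5), the «OR BALL PLACES» half of row 5's signed scope TAME/BALL: the enlarged packet stratum `Σ₅♭ ⊇ Σ₅`
# (boundary-torsion-free packets whose bad places satisfy the H⋆₅ cell), «S_H restricted to Σ₅♭» PROVED, the weakened Corollary and the abc endpoint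

Seat abc-iut-rh-typ-5 (gen 3; R-H ROUND 2 tranche 1, director-abc g3 2026-08-26T19:46:32Z item (3)). PROOF + 2 claim-tagged defs; sequel of this seat's
`RHTameBandLicenceSigma` (p472055: Σ₅ over UNIFORMLY TAME primes `e_p ≤ p − 2`) and `RHTameBandLicenceSigmaAbc` (p472385: the Q2(5) endpoint), closing
the census item left there: ROUND1.tsv row 5 was signed on the «TAME/BALL stratum» (round 1's ball rider `RH.TameBandLicence.HStarBallBandLicence`, p460586),
and a BALL place — `p > 2`, `e_w ≤ p − 1`, `μ_p(K_w) = 1`, so `log_p(𝒪^×) = 𝔪` (`Literature.IUT.LogVolume.TorsionFree.logUnits_eq_closedBall_of_le_pred`,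
[IUTchIV] Prop. 1.2 (i) + Neukirch II (5.7)) — carries the SAME cell as a tame one (abc-iut-D1-prv p456609). Consumed BY NAME: abc-iut-w5-d180 /
abc-iut-D1-prv's per-packet BALL movers `Real.qRegion_subset_thetaHull_settingDHVolSharp_of_ball_orders` (`Cor312LicenceBallFibreMovers`), rh2-q2-eq's
`RH.SigmaLicence` / `RH.SigmaStrataEq.GenuineK.cor312UpTo_of_licenceOn`, rh2-q2-cond's `Conditional.Cor312Slack.ABC_of_cor312Slack_of_hullRegime` (p469667),
abc-iut-s2-p6's Θ-side, and §1–§4 of `RHTameBandLicenceSigma`.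

WHAT IS TYPED / PROVED (namespace `Summit.ABC.IUTFork.Repair.RH.TameBandLicenceSigmaBall`; window bed `P := settingPrVolSharp (pilotDataOfK D K) …`,
realising ideles):
* §1 `UniformlyBallAt D p` (`p > 2`, one index `e_p ≤ p − 1` at every place of `K` over `p`, and no non-trivial `p`-th root of unity in any `K_x`,
  `x ∣ p`); `uniformlyBallAt_of_uniformlyTameAt` (tame ⟹ ball, `Real.forall_pow_prime_eq_one_of_absRamificationIdx_le_sub_two`); **`sigmaFiveBall D`** =
  Σ₅♭: archimedean packets, packets over primes under no bad place, and packets `(i, p)` over a uniformly BALL prime whose every bad `w ∣ p` satisfies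
  `Cell e_w P_w (i+1)`; `sigmaFive_subset_sigmaFiveBall`; `mem_sigmaFiveBall_of_hStarBall` (under H⋆₅♭ every uniformly-ball packet is in Σ₅♭).
* §2 **`licenceOn_sigmaFiveBall` — «S_H RESTRICTED TO Σ₅♭» HOLDS** (PROVED; ball fibres: `logUnits = closedBall 0 ‖ϖ‖` from the torsion-free
  criterion, then the ball movers with the cell as window via `cell_iff_tame_exact`).
* §3 `statementUpTo_offRemainder_sigmaFiveBall` (the weakened Corollary with `R_{Σ₅♭}`), `offRemainder_sigmaFiveBall_le_sigmaFive` (`R_{Σ₅♭} ≤ R_{Σ₅}`,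
  antitone); §4 `GenuineK.cor312UpTo_sigmaFiveBall` (genuine `K`-level datum, ALL realising ideles, NO S_H binder) — so the abc endpoint
  `TameBandLicenceSigmaAbc.abc_of_offRemainder_sigmaFive_le_tol` covers the ball scope a fortiori (smaller remainder).
HONEST FRAMING: READING PREDICATES over OUR typed objects; H⋆₅/H⋆₅♭ are HYPOTHESES; nothing here asserts that abc is proved or refuted, or that
[IUTchIII] Cor. 3.12 holds or fails at any datum, or takes a side on any author; typed ≠ proved; instantiated ≠ endorsed.
[cite: Mochizuki2012, IUTchI Ex. 3.2 (iv) p. 71; IUTchIII Cor. 3.12 p. 173–174, Step (xi-f) p. 184; IUTchIV Prop. 1.2 (i)(ii) p. 10]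
[cite: NeukirchANT1999, Ch. II Prop. (5.5)–(5.7)] [cite: DupuyHilado2025, §3.3, §3.4, §4.9] [claim: Mochizuki2012, status: disputed]. Axioms: standard.
-/

noncomputable section
open Set Metric Function NumberField IsDedekindDomain
open scoped Pointwise

namespace Summit.ABC.IUTFork.Repair.RH.TameBandLicenceSigmaBall

open Literature.AnabelianGeometry.AbsoluteAnabelian Literature.IUT.LogThetaLattice Literature.IUT.LogVolume
  Literature.IUT.HodgeTheaters Literature.NumberTheory.NumberFields Literature.NumberTheory.GaloisRepresentations.Ultrametric
open Summit.ABC.IUTFork.Thm311 Summit.ABC.IUTFork.Thm311.Real Summit.ABC.IUTFork.Cor312 Summit.ABC.IUTFork.Cor312.Setting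
  Summit.ABC.IUTFork.Cor312Vol Summit.ABC.IUTFork.Cor312Prov Summit.ABC.IUTFork.Repair.RH.TameBandLicence
  Summit.ABC.IUTFork.Repair.RH.SigmaLicence Summit.ABC.IUTFork.Repair.RH.TameBandLicenceSigma Literature.IUT.LogVolume.ThetaData

section Generic

variable {F K Fbar : Type} [Field F] [NumberField F] [Field K] [NumberField K] [Algebra F K] [Field Fbar]
  [Algebra F Fbar] [Algebra K Fbar] {E : WeierstrassCurve F} [E.IsElliptic] {l : ℕ} {Pb : BadPlacePredicates K}
  (D : InitialThetaData F K Fbar E l Pb)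

/-! ## §1. The ball stratum `Σ₅♭ ⊇ Σ₅` -/

/-- **`UniformlyBallAt D p`** — `p` is odd, EVERY place of `K` over `p` has the same absolute ramification index `e_p ≤ p − 1`, and no completion `K_x`,
`x ∣ p`, contains a non-trivial `p`-th root of unity (so `log_p(𝒪^×_{K_x}) = 𝔪_{K_x}`: round 1's ball places, per prime). READING PREDICATE over
`pilotDataOfK D K`. [cite: Mochizuki2012, IUTchIV Prop. 1.2 (i)(ii) p. 10] [cite: NeukirchANT1999, Ch. II Prop. (5.7)] [claim: Mochizuki2012, status: disputed] -/
@[claim "Mochizuki2012" "disputed"]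
def UniformlyBallAt (pp : Nat.Primes) : Prop :=
  haveI : Fact (pp : ℕ).Prime := ⟨pp.2⟩
  2 < (pp : ℕ) ∧ ∃ e : ℕ, e ≤ (pp : ℕ) - 1 ∧
    ∀ x : (thetaIndex (pilotDataOfK D K)).Fibre (.inr pp), (placeOf (pilotDataOfK D K) pp.1 x).asIdeal.ramificationIdx ℤ = e ∧
      ∀ ζ : kOf (pilotDataOfK D K) pp.1 x, ζ ^ (pp : ℕ) = 1 → ζ = 1

/-- **Tame ⟹ ball**: a uniformly tame prime is a uniformly ball prime (`e ≤ p − 2 ≤ p − 1`; no `ζ_p` by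
`Real.forall_pow_prime_eq_one_of_absRamificationIdx_le_sub_two`). [cite: NeukirchANT1999, Ch. II Prop. (5.7)] -/
theorem uniformlyBallAt_of_uniformlyTameAt (pp : Nat.Primes) (h : UniformlyTameAt D pp) : UniformlyBallAt D pp := by
  haveI : Fact (pp : ℕ).Prime := ⟨pp.2⟩
  obtain ⟨hp2, e, hep, he⟩ := h
  refine ⟨hp2, e, by omega, fun x => ⟨he x, ?_⟩⟩
  have heK : absRamificationIdx (pp : ℕ) (kOf (pilotDataOfK D K) pp.1 x) = (placeOf (pilotDataOfK D K) pp.1 x).asIdeal.ramificationIdx ℤ :=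
    absRamificationIdx_rescaledCompletion K (pp : ℕ) (placeOf (pilotDataOfK D K) pp.1 x) (natCast_mem_placeOf (pilotDataOfK D K) pp.1 x)
  exact forall_pow_prime_eq_one_of_absRamificationIdx_le_sub_two (pp : ℕ) (kOf (pilotDataOfK D K) pp.1 x) hp2 (by rw [heK, he x]; exact hep)

/-- **`sigmaFiveBall D` — THE BALL STRATUM `Σ₅♭`** of row 5's signed scope TAME/BALL: every archimedean packet; every packet over a prime under NO bad
place; and the packets `(i, p)` over a UNIFORMLY BALL prime at which every BAD place `w ∣ p` satisfies round 1's cell `Cell e_w P_w (i+1)`. READING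
PREDICATE; never asserted. [cite: Mochizuki2012, IUTchIII Cor. 3.12 Step (xi-f) p. 184; IUTchIV Prop. 1.2 (i)(ii) p. 10] [claim: Mochizuki2012, status: disputed] -/
@[claim "Mochizuki2012" "disputed"]
def sigmaFiveBall : Set (Fin (thetaIndex (pilotDataOfK D K)).lstar × (thetaIndex (pilotDataOfK D K)).VQ) :=
  {c | match c.2 with
    | .inl _ => True
    | .inr pp =>
      haveI : Fact (pp : ℕ).Prime := ⟨pp.2⟩
      (∀ w : (thetaIndex (pilotDataOfK D K)).Fibre (.inr pp), placeOf (pilotDataOfK D K) pp.1 w ∉ (pilotDataOfK D K).S) ∨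
        (UniformlyBallAt D pp ∧
          ∀ w : (thetaIndex (pilotDataOfK D K)).Fibre (.inr pp), placeOf (pilotDataOfK D K) pp.1 w ∈ (pilotDataOfK D K).S →
            ∀ P : ℕ, (pilotDataOfK D K).qPilot (placeOf (pilotDataOfK D K) pp.1 w) = P →
              Cell (((placeOf (pilotDataOfK D K) pp.1 w).asIdeal.ramificationIdx ℤ : ℕ) : ℤ) (P : ℤ) (((c.1 : ℕ) + 1 : ℕ) : ℤ))}

/-- Membership of a prime packet in Σ₅♭, unfolded. [folklore] -/
theorem mem_sigmaFiveBall_inr_iff (i : Fin (thetaIndex (pilotDataOfK D K)).lstar) (pp : Nat.Primes) :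
    (i, Sum.inr pp) ∈ sigmaFiveBall D ↔
      haveI : Fact (pp : ℕ).Prime := ⟨pp.2⟩
      (∀ w : (thetaIndex (pilotDataOfK D K)).Fibre (.inr pp), placeOf (pilotDataOfK D K) pp.1 w ∉ (pilotDataOfK D K).S) ∨
        (UniformlyBallAt D pp ∧
          ∀ w : (thetaIndex (pilotDataOfK D K)).Fibre (.inr pp), placeOf (pilotDataOfK D K) pp.1 w ∈ (pilotDataOfK D K).S →
            ∀ P : ℕ, (pilotDataOfK D K).qPilot (placeOf (pilotDataOfK D K) pp.1 w) = P →
              Cell (((placeOf (pilotDataOfK D K) pp.1 w).asIdeal.ramificationIdx ℤ : ℕ) : ℤ) (P : ℤ) (((i : ℕ) + 1 : ℕ) : ℤ)) :=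
  Iff.rfl

/-- **`Σ₅ ⊆ Σ₅♭`.** [folklore] -/
theorem sigmaFive_subset_sigmaFiveBall : sigmaFive D ⊆ sigmaFiveBall D := by
  rintro ⟨i, vQ⟩ h
  cases vQ with
  | inl u => trivial
  | inr pp =>
    rcases (mem_sigmaFive_inr_iff D i pp).1 h with hS | ⟨htame, hcell⟩
    · exact (mem_sigmaFiveBall_inr_iff D i pp).2 (Or.inl hS)
    · exact (mem_sigmaFiveBall_inr_iff D i pp).2 (Or.inr ⟨uniformlyBallAt_of_uniformlyTameAt D pp htame, hcell⟩)

/-- **Under the ball rider H⋆₅♭ every packet over a uniformly ball prime is in Σ₅♭.** [claim: Mochizuki2012, status: disputed] -/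
theorem mem_sigmaFiveBall_of_hStarBall (hH : HStarBallBandLicence D) (i : Fin (thetaIndex (pilotDataOfK D K)).lstar) (pp : Nat.Primes)
    (hball : UniformlyBallAt D pp) : (i, Sum.inr pp) ∈ sigmaFiveBall D := by
  haveI : Fact (pp : ℕ).Prime := ⟨pp.2⟩
  refine (mem_sigmaFiveBall_inr_iff D i pp).2 (Or.inr ⟨hball, fun w hw P hP => ?_⟩)
  obtain ⟨hp2, e, hep, he⟩ := hball
  exact hH pp i w hw hp2 (by rw [(he w).1]; exact hep) (he w).2 P hP

/-! ## §2. «S_H restricted to Σ₅♭» HOLDS at the window bed with realising ideles -/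
variable {logv : PadicLogs K} (hlog : LogvAnalytic logv)
  (M : Type) [Field M] [NumberField M]
  (archPk : ∀ (j : (thetaIndex (pilotDataOfK D K)).Label) (vQ : (thetaIndex (pilotDataOfK D K)).VQ),
    Set ((logShellsDH (pilotDataOfK D K) logv).Packet j vQ))
  (archSub : ∀ (j : (thetaIndex (pilotDataOfK D K)).Label) (v : (thetaIndex (pilotDataOfK D K)).V),
    Set ((logShellsDH (pilotDataOfK D K) logv).Packet j ((thetaIndex (pilotDataOfK D K)).over v)))
  (Ψ : ℤ → ∀ v : (thetaIndex (pilotDataOfK D K)).V, v ∈ (thetaIndex (pilotDataOfK D K)).Vbad →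
    Set ((logShellsDH (pilotDataOfK D K) logv).StarPacket v))
  (act : ℤ → ∀ v : (thetaIndex (pilotDataOfK D K)).V, v ∈ (thetaIndex (pilotDataOfK D K)).Vbad →
    (logShellsDH (pilotDataOfK D K) logv).StarPacket v → Module.End ℚ ((logShellsDH (pilotDataOfK D K) logv).StarPacket v))
  (Mmod : ℤ → ∀ j : (thetaIndex (pilotDataOfK D K)).LabelStar, Set ((logShellsDH (pilotDataOfK D K) logv).GlobalPacket j.1))
  (region : ℤ → ∀ j : (thetaIndex (pilotDataOfK D K)).LabelStar, FinDivisor M → ∀ vQ : (thetaIndex (pilotDataOfK D K)).VQ,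
    Set ((logShellsDH (pilotDataOfK D K) logv).Packet j.1 vQ))
  (n : ℤ) {HT : Type} {LogLink : HT → HT → Type} {IsFull : ∀ {s t : HT}, LogLink s t → Prop}
  (lat : LGPGaussianLogThetaLattice LogLink IsFull)
  {Frd : Type} {IsoF : Frd → Frd → Type} {Ob : Frd → Type} {realify : Frd → Frd} {Strip : Type}
  {IsoS : Strip → Strip → Type} {Mv : ∀ v : (thetaIndex (pilotDataOfK D K)).V, v ∈ (thetaIndex (pilotDataOfK D K)).Vbad → Type}
  [∀ v h, Monoid (Mv v h)]
  (sig : GlobalLGPFrobenioidSignature (thetaIndex (pilotDataOfK D K)).lstar (thetaIndex (pilotDataOfK D K)).V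
    (· ∈ (thetaIndex (pilotDataOfK D K)).Vbad) Frd IsoF Ob realify Strip IsoS Mv)
  (split : SplittingMonoids Mv) {ObΔ : Type} {N : ∀ v : (thetaIndex (pilotDataOfK D K)).V, v ∈ (thetaIndex (pilotDataOfK D K)).Vbad → Type}
  [∀ v h, Monoid (N v h)] (qData : QPilotData ObΔ N)
  (tq : ∀ (pp : Nat.Primes) (x : (thetaIndex (pilotDataOfK D K)).Fibre (.inr pp)),
    haveI : Fact (pp : ℕ).Prime := ⟨pp.2⟩; kOf (pilotDataOfK D K) pp.1 x)
  (t : ∀ (pp : Nat.Primes) (_ : Fin (pilotDataOfK D K).lstar) (x : (thetaIndex (pilotDataOfK D K)).Fibre (.inr pp)),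
    haveI : Fact (pp : ℕ).Prime := ⟨pp.2⟩; kOf (pilotDataOfK D K) pp.1 x)
  (htq0 : ∀ pp x, tq pp x ≠ 0)
  (htq1 : ∀ (pp : Nat.Primes) (x : (thetaIndex (pilotDataOfK D K)).Fibre (.inr pp)),
    haveI : Fact (pp : ℕ).Prime := ⟨pp.2⟩; placeOf (pilotDataOfK D K) pp.1 x ∉ (pilotDataOfK D K).S → ‖tq pp x‖ = 1)
  (ht0 : ∀ pp i x, t pp i x ≠ 0)
  (ht : ∀ (pp : Nat.Primes) (i : Fin (pilotDataOfK D K).lstar) (x : (thetaIndex (pilotDataOfK D K)).Fibre (.inr pp)),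
    haveI : Fact (pp : ℕ).Prime := ⟨pp.2⟩
    Real.log ‖t pp i x‖ = -((pilotDataOfK D K).thetaPilot i (placeOf (pilotDataOfK D K) pp.1 x)) *
      logNorm K (placeOf (pilotDataOfK D K) pp.1 x) / localDegree K (placeOf (pilotDataOfK D K) pp.1 x))
  (htq : ∀ (pp : Nat.Primes) (x : (thetaIndex (pilotDataOfK D K)).Fibre (.inr pp)),
    haveI : Fact (pp : ℕ).Prime := ⟨pp.2⟩
    Real.log ‖tq pp x‖ = -((pilotDataOfK D K).qPilot (placeOf (pilotDataOfK D K) pp.1 x)) *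
      logNorm K (placeOf (pilotDataOfK D K) pp.1 x) / localDegree K (placeOf (pilotDataOfK D K) pp.1 x))

include htq0 htq ht0 ht in
/-- **«S_H RESTRICTED TO Σ₅♭» HOLDS.** At the window bed with REALISING ideles, rh2-q2-eq's `LicenceOn P Σ₅♭` holds: Σ₅-packets as in
`TameBandLicenceSigma.licenceOn_sigmaFive`; at a uniformly BALL packet whose bad places satisfy the cells, by the per-packet BALL movers
(`Real.qRegion_subset_thetaHull_settingDHVolSharp_of_ball_orders`) — the ball fibre condition `log_p(𝒪^×) = 𝔪` from the torsion-free criterion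
`TorsionFree.logUnits_eq_closedBall_of_le_pred`, the window = the cell via `cell_iff_tame_exact`, the uniformizer norms of realising ideles
(`TameBandLicenceSigma.norm_ideles_eq_zpow_uniformizer`); good places over the same prime need nothing (`‖t‖ = ‖t_q‖ = 1`).
[cite: Mochizuki2012, IUTchIII Step (xi-f) p. 184; IUTchIV Prop. 1.2 (i)(ii) p. 10] [cite: NeukirchANT1999, Ch. II Prop. (5.7)] [claim: Mochizuki2012, status: disputed] -/
theorem licenceOn_sigmaFiveBall :
    LicenceOn (settingPrVolSharp (pilotDataOfK D K) hlog M archPk archSub Ψ act Mmod region n lat sig split qData tq t htq0 htq1)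
      (sigmaFiveBall D) := by
  have ht1 := fun pp i x hx => norm_eq_one_of_realises (pilotDataOfK D K) t ht0 ht pp i x hx
  rintro ⟨i, vQ⟩ hmem
  show (settingDHVolSharp (pilotDataOfK D K) hlog M archPk archSub Ψ act Mmod region n lat sig split qData tq t htq0 htq1).qRegion
      (labelSucc i) vQ ⊆
    (settingDHVolSharp (pilotDataOfK D K) hlog M archPk archSub Ψ act Mmod region n lat sig split qData tq t htq0 htq1).thetaHull
      (labelSucc i) vQ
  cases vQ with
  | inl u =>
    exact qRegion_subset_thetaHull_settingDHVolSharp_inl (pilotDataOfK D K) hlog M archPk archSub Ψ act Mmod region n lat sig split qData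
      tq t htq0 htq1 (labelSucc i) u
  | inr pp =>
    haveI hF : Fact (pp : ℕ).Prime := ⟨pp.2⟩
    rcases (mem_sigmaFiveBall_inr_iff D i pp).1 hmem with hS | ⟨⟨hp2, e, hep, he⟩, hcell⟩
    · exact qRegion_subset_thetaHull_settingDHVolSharp_of_forall_not_mem (pilotDataOfK D K) hlog M archPk archSub Ψ act Mmod region n
        lat sig split qData tq t htq0 htq1 i pp ht1 hS
    · -- uniformizers of norm `p^{-1/e}` at every place over `p`; ball-shaped unit logs by the torsion-free criterion
      have hex : ∀ x : (thetaIndex (pilotDataOfK D K)).Fibre (.inr pp),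
          ∃ ϖ : (kOf (pilotDataOfK D K) pp.1 x)ˣ, IsUniformizer ϖ ∧ ‖(ϖ : kOf (pilotDataOfK D K) pp.1 x)‖ =
            ((pp : ℕ) : ℝ) ^ (-(1 / ((placeOf (pilotDataOfK D K) pp.1 x).asIdeal.ramificationIdx ℤ : ℝ))) := fun x =>
        exists_isUniformizer_rescaledCompletion K pp.1 (placeOf (pilotDataOfK D K) pp.1 x) (natCast_mem_placeOf (pilotDataOfK D K) pp.1 x)
      choose ϖ hϖ using hex
      have hball : ∀ x : (thetaIndex (pilotDataOfK D K)).Fibre (.inr pp),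
          logUnits (kOf (pilotDataOfK D K) pp.1 x) = closedBall (0 : kOf (pilotDataOfK D K) pp.1 x) ‖(ϖ x : kOf (pilotDataOfK D K) pp.1 x)‖ := by
        intro x
        have heK : absRamificationIdx (pp : ℕ) (kOf (pilotDataOfK D K) pp.1 x) = e :=
          (absRamificationIdx_rescaledCompletion K (pp : ℕ) (placeOf (pilotDataOfK D K) pp.1 x)
            (natCast_mem_placeOf (pilotDataOfK D K) pp.1 x)).trans (he x).1
        exact TorsionFree.logUnits_eq_closedBall_of_le_pred (pp : ℕ) (hϖ x).1 (he x).2 (Nat.ne_of_gt hp2) (by rw [heK]; exact hep)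
      refine qRegion_subset_thetaHull_settingDHVolSharp_of_ball_orders (pilotDataOfK D K) hlog M archPk archSub Ψ act Mmod region n lat
        sig split qData tq t htq0 htq1 i pp e ϖ (fun x => ⟨(he x).1, (hϖ x).1, hball x⟩) fun w => ?_
      by_cases hw : placeOf (pilotDataOfK D K) pp.1 w ∈ (pilotDataOfK D K).S
      · obtain ⟨P, hP, hP1, -⟩ := exists_nat_qPilot_pilotDataOfK D hw
        obtain ⟨hΘn, hqn⟩ := norm_ideles_eq_zpow_uniformizer D tq t htq0 ht0 ht htq pp i w (ϖ w) (hϖ w).2 P hP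
        have he0 : (0 : ℤ) < ((placeOf (pilotDataOfK D K) pp.1 w).asIdeal.ramificationIdx ℤ : ℤ) := by
          exact_mod_cast ramificationIdx_placeOf_pos D pp w
        have hc := (cell_iff_tame_exact he0 (P : ℤ) (((i : ℕ) + 1 : ℕ) : ℤ)).1 (hcell w hw P hP)
        refine Or.inr ⟨((((i : ℕ) + 1) ^ 2 * P : ℕ) : ℤ), ((P : ℕ) : ℤ), hΘn, hqn, ?_, ?_⟩
        · have h1 : 1 ≤ ((i : ℕ) + 1) ^ 2 * P := Nat.one_le_iff_ne_zero.2 (by positivity)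
          exact_mod_cast h1
        · rw [← (he w).1]
          push_cast at hc ⊢
          linarith
      · exact Or.inl (by rw [ht1 pp i w hw, htq1 pp w hw])

/-! ## §3. The weakened Corollary with `R_{Σ₅♭} ≤ R_{Σ₅}`; the genuine datum with NO S_H binder -/

include ht0 ht htq in
/-- **The weakened Corollary from «S_H on Σ₅♭» (PROVED):** `StatementUpTo P (offRemainder P Σ₅♭)` at the window bed with realising ideles.
[cite: Mochizuki2012, IUTchIII Cor. 3.12 p. 173–174] [claim: Mochizuki2012, status: disputed] -/
theorem statementUpTo_offRemainder_sigmaFiveBall :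
    StatementUpTo (settingPrVolSharp (pilotDataOfK D K) hlog M archPk archSub Ψ act Mmod region n lat sig split qData tq t htq0 htq1)
      (offRemainder (settingPrVolSharp (pilotDataOfK D K) hlog M archPk archSub Ψ act Mmod region n lat sig split qData tq t htq0 htq1)
        (sigmaFiveBall D)) := by
  have ht1 := fun pp i x hx => norm_eq_one_of_realises (pilotDataOfK D K) t ht0 ht pp i x hx
  exact statementUpTo_offRemainder_of_licenceOn
    (bridgeHyps_settingPrVolSharp_of_ideles (pilotDataOfK D K) hlog M archPk archSub Ψ act Mmod region n lat sig split qData t tq ht0 ht1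
      htq0 htq1)
    (licenceOn_sigmaFiveBall D hlog M archPk archSub Ψ act Mmod region n lat sig split qData tq t htq0 htq1 ht0 ht htq)

include ht0 ht in
/-- **`R_{Σ₅♭} ≤ R_{Σ₅}`**: the ball stratum charges no more than the tame one (rh2-q2-eq's `offRemainder_anti`). [folklore] -/
theorem offRemainder_sigmaFiveBall_le_sigmaFive :
    offRemainder (settingPrVolSharp (pilotDataOfK D K) hlog M archPk archSub Ψ act Mmod region n lat sig split qData tq t htq0 htq1)
        (sigmaFiveBall D) ≤
      offRemainder (settingPrVolSharp (pilotDataOfK D K) hlog M archPk archSub Ψ act Mmod region n lat sig split qData tq t htq0 htq1)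
        (sigmaFive D) := by
  have ht1 := fun pp i x hx => norm_eq_one_of_realises (pilotDataOfK D K) t ht0 ht pp i x hx
  exact offRemainder_anti
    (bridgeHyps_settingPrVolSharp_of_ideles (pilotDataOfK D K) hlog M archPk archSub Ψ act Mmod region n lat sig split qData t tq ht0 ht1
      htq0 htq1) (sigmaFive_subset_sigmaFiveBall D)

end Generic

/-! ## §4. The genuine `K`-level datum: Cor. 3.12 up to `R_{Σ₅♭}`, NO S_H binder (all realising ideles) -/

section Datum

variable {F K Fbar : Type} [Field F] [NumberField F] [Field K] [NumberField K] [Algebra F K] [Field Fbar]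
  [Algebra F Fbar] [Algebra K Fbar] {E : WeierstrassCurve F} [E.IsElliptic] {l : ℕ} {Pb : BadPlacePredicates K}
  (D : InitialThetaData F K Fbar E l Pb) {I : ThetaVolumeInput (fieldOfModuli E) K}
  (M : Type) [Field M] [NumberField M]
  (archPk : ∀ (j : (thetaIndex (pilotDataOfK D K)).Label) (vQ : (thetaIndex (pilotDataOfK D K)).VQ),
    Set ((logShellsDH (pilotDataOfK D K) (analyticLogv K)).Packet j vQ))
  (archSub : ∀ (j : (thetaIndex (pilotDataOfK D K)).Label) (v : (thetaIndex (pilotDataOfK D K)).V),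
    Set ((logShellsDH (pilotDataOfK D K) (analyticLogv K)).Packet j ((thetaIndex (pilotDataOfK D K)).over v)))
  (Ψ : ℤ → ∀ v : (thetaIndex (pilotDataOfK D K)).V, v ∈ (thetaIndex (pilotDataOfK D K)).Vbad →
    Set ((logShellsDH (pilotDataOfK D K) (analyticLogv K)).StarPacket v))
  (act : ℤ → ∀ v : (thetaIndex (pilotDataOfK D K)).V, v ∈ (thetaIndex (pilotDataOfK D K)).Vbad →
    (logShellsDH (pilotDataOfK D K) (analyticLogv K)).StarPacket v →
      Module.End ℚ ((logShellsDH (pilotDataOfK D K) (analyticLogv K)).StarPacket v))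
  (Mmod : ℤ → ∀ j : (thetaIndex (pilotDataOfK D K)).LabelStar,
    Set ((logShellsDH (pilotDataOfK D K) (analyticLogv K)).GlobalPacket j.1))
  (region : ℤ → ∀ j : (thetaIndex (pilotDataOfK D K)).LabelStar, FinDivisor M → ∀ vQ : (thetaIndex (pilotDataOfK D K)).VQ,
    Set ((logShellsDH (pilotDataOfK D K) (analyticLogv K)).Packet j.1 vQ))
  (n : ℤ) {HT : Type} {LogLink : HT → HT → Type} {IsFull : ∀ {s t : HT}, LogLink s t → Prop}
  (lat : LGPGaussianLogThetaLattice LogLink IsFull)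
  {Frd : Type} {IsoF : Frd → Frd → Type} {Ob : Frd → Type} {realify : Frd → Frd} {Strip : Type}
  {IsoS : Strip → Strip → Type}
  {Mv : ∀ v : (thetaIndex (pilotDataOfK D K)).V, v ∈ (thetaIndex (pilotDataOfK D K)).Vbad → Type} [∀ v h, Monoid (Mv v h)]
  (sig : GlobalLGPFrobenioidSignature (thetaIndex (pilotDataOfK D K)).lstar (thetaIndex (pilotDataOfK D K)).V
    (· ∈ (thetaIndex (pilotDataOfK D K)).Vbad) Frd IsoF Ob realify Strip IsoS Mv)
  (split : SplittingMonoids Mv) {ObΔ : Type}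
  {N : ∀ v : (thetaIndex (pilotDataOfK D K)).V, v ∈ (thetaIndex (pilotDataOfK D K)).Vbad → Type} [∀ v h, Monoid (N v h)]
  (qData : QPilotData ObΔ N)
  (tq : ∀ (pp : Nat.Primes) (x : (thetaIndex (pilotDataOfK D K)).Fibre (.inr pp)),
    haveI : Fact (pp : ℕ).Prime := ⟨pp.2⟩; kOf (pilotDataOfK D K) pp.1 x)
  (t : ∀ (pp : Nat.Primes) (_ : Fin (pilotDataOfK D K).lstar) (x : (thetaIndex (pilotDataOfK D K)).Fibre (.inr pp)),
    haveI : Fact (pp : ℕ).Prime := ⟨pp.2⟩; kOf (pilotDataOfK D K) pp.1 x)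
  (htq0 : ∀ pp x, tq pp x ≠ 0)
  (htq1 : ∀ (pp : Nat.Primes) (x : (thetaIndex (pilotDataOfK D K)).Fibre (.inr pp)),
    haveI : Fact (pp : ℕ).Prime := ⟨pp.2⟩; placeOf (pilotDataOfK D K) pp.1 x ∉ (pilotDataOfK D K).S → ‖tq pp x‖ = 1)

include htq0 htq1 in
/-- **ROW 5 (TAME/BALL scope) AT THE DATUM, NO S_H BINDER**: at the genuine `K`-level pilot datum, for EVERY context of abc-iut-c312-7's sharp
print-normalised setting and ALL realising ideles, `I.negAbsLogQ ≤ I.negLogTheta + R_{Σ₅♭}` (rh2-q2-eq's `GenuineK.cor312UpTo_of_licenceOn` ∘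
`licenceOn_sigmaFiveBall` ∘ abc-iut-s2-p6's Θ-side); with `R_{Σ₅♭} ≤ R_{Σ₅}` the abc endpoint `TameBandLicenceSigmaAbc.abc_of_offRemainder_sigmaFive_le_tol`
covers the ball scope a fortiori, and `Conditional.Cor312Slack.ABC_of_cor312Slack_of_hullRegime` applies verbatim with `ε := R_{Σ₅♭}`.
[cite: Mochizuki2012, IUTchIII Cor. 3.12 p. 173–174; IUTchI Ex. 3.2 (iv) p. 71] [claim: Mochizuki2012, status: disputed] -/
theorem GenuineK.cor312UpTo_sigmaFiveBall (hI : ThetaData.IsVolumeInputOf D I) (ht0 : ∀ pp i x, t pp i x ≠ 0)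
    (ht1 : ∀ (pp : Nat.Primes) (i : Fin (pilotDataOfK D K).lstar) (x : (thetaIndex (pilotDataOfK D K)).Fibre (.inr pp)),
      haveI : Fact (pp : ℕ).Prime := ⟨pp.2⟩; placeOf (pilotDataOfK D K) pp.1 x ∉ (pilotDataOfK D K).S → ‖t pp i x‖ = 1)
    (htq : ∀ (pp : Nat.Primes) (x : (thetaIndex (pilotDataOfK D K)).Fibre (.inr pp)),
      haveI : Fact (pp : ℕ).Prime := ⟨pp.2⟩
      Real.log ‖tq pp x‖ = -((pilotDataOfK D K).qPilot (placeOf (pilotDataOfK D K) pp.1 x)) *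
        logNorm K (placeOf (pilotDataOfK D K) pp.1 x) / localDegree K (placeOf (pilotDataOfK D K) pp.1 x))
    (hT : ∀ (pp : Nat.Primes) (i : Fin (pilotDataOfK D K).lstar) (x : (thetaIndex (pilotDataOfK D K)).Fibre (.inr pp)),
      haveI : Fact (pp : ℕ).Prime := ⟨pp.2⟩
      Real.log ‖t pp i x‖ = -((pilotDataOfK D K).thetaPilot i (placeOf (pilotDataOfK D K) pp.1 x)) *
        logNorm K (placeOf (pilotDataOfK D K) pp.1 x) / localDegree K (placeOf (pilotDataOfK D K) pp.1 x)) :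
    I.negAbsLogQ ≤ I.negLogTheta +
      offRemainder
        (settingPrVolSharp (pilotDataOfK D K) (logvAnalytic_analyticLogv (F := K)) M archPk archSub Ψ act Mmod region n lat sig split
          qData tq t htq0 htq1)
        (sigmaFiveBall D) :=
  SigmaStrataEq.GenuineK.cor312UpTo_of_licenceOn D K M archPk archSub Ψ act Mmod region n lat sig split qData t tq hI htq0 htq1 ht0 ht1 htq
    (licenceOn_sigmaFiveBall D (logvAnalytic_analyticLogv (F := K)) M archPk archSub Ψ act Mmod region n lat sig split qData tq t htq0 htq1
      ht0 hT htq)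
    (negLogTheta_settingPrVolSharp_pilotDataOfK_le_genuine D M archPk archSub Ψ act Mmod region n lat sig split qData tq t htq0 htq1 ht0
      hT hI)

end Datum

end Summit.ABC.IUTFork.Repair.RH.TameBandLicenceSigmaBall

end
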